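import Literature.Computability.Cryptography.RegevSamplerAdmissible
import HarnessLib

/-!
# Regev 2009, Lemma 3.14 in machine form: the ideal `CVP` answer on a short point and the exact erasure

Topic `Computability/Cryptography` (family `pqc`), grouping namespace `Regev2009.SamplerArith`; sequel
of `RegevSamplerAdmissible.lean` (`point_sNat_eq_floor_sub`: the query point of the residues of a grid
point `x` is its lattice part `⌊x⌋_Λ` translated by the point `−Σⱼ mⱼ b∨ⱼ ∈ L*`) and of
`RegevCVPOracleFn.lean` (`CVPOracle.coords`: the IDEAL oracle's answer — the dual coordinates of the
point of `L*` within `λ₁(L*)/2` of the query point; `answerFn`: the ideal answer function on query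
strings). In Regev's sampler (J. ACM 56 (2009), art. 34; author's version arXiv:2401.03703, Lemma 3.14,
proof: "using the `CVP` oracle, we can recover `x` … this allows us to uncompute the first register")
the recomposition `recover` of `RegevSamplerArith.lean` erases `x` exactly from the branch, the residues
and the answer `c = −m` (`recover_ytil`). This file proves that the IDEAL answer IS `−m` on every grid
point whose lattice part is shorter than `λ₁(L*)/2` — so those points are GOOD (clean final label) in
the register analysis `Algebra/EuclideanLattices/RegevQuantumPartFibres.lean` (`FibreHyps.good_short`):

* `coords_point_sNat` — `coords I (point I (sNat x, ℓ_R, b_c)) = −mVec x` when `‖⌊x⌋_Λ‖ < λ₁(L*)/2`;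
* `answerTable_sNat` — the answer table is then `tableZ b_c (−mVec x)`;
* `answerFn_of_ofFn_eq` — the ideal answer function at any query width, on a register holding the
  query string of in-range data, is the answer table (general-width form of `answerFn_query`);
* **`recover_coords_eq`** — `recover (ỹ, s, coords) = x̃`: the erasure of the first register is exact
  on such points.

Everything is proved; no definition, no named fact is introduced.

## References

* O. Regev, *On lattices, learning with errors, random linear codes, and cryptography*, J. ACM 56
  (2009), art. 34; author's version arXiv:2401.03703: Lemma 3.14 (proof, p. 20), Lemma 3.4, Lemma 3.3
  (proof, p. 15) [Regev2009].
* D. Micciancio, S. Goldwasser, *Complexity of Lattice Problems*, Kluwer 2002, Ch. 1 §1.1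
  [MicciancioGoldwasser2002].
-/

noncomputable section

namespace Literature.Computability.Cryptography

namespace Regev2009

namespace SamplerArith

open Literature.Algebra.EuclideanLattices Literature.Algebra.EuclideanLattices.Regev2009 Peikert2009 Matrix
  Finset SamplerQuery CVPOracle
open scoped InnerProductSpace

/-! ### The ideal answer function at any query width -/

/-- **The ideal answer function on a register holding the query string of in-range data is the answer
table** (any query width). [cite: Regev2009, Lemma 3.3 (proof: "an oracle that solves CVP_{L*,αp/(√2 r)}")] -/
theorem answerFn_of_ofFn_eq (I : LatticeInstance) (r : ℚ) (k : ℕ) (y : List Bool) {K : ℕ} (ℓ : ℕ) {xq : QReg K}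
    {c : QData I.n} (hc : InRange c) (hx : List.ofFn xq = query I r k y c) :
    answerFn I r k y K ℓ xq = fun i : Fin ℓ => (answerTable I c).getD (i : ℕ) false := by
  classical
  have hex : ∃ c' : QData I.n, InRange c' ∧ List.ofFn xq = query I r k y c' := ⟨c, hc, hx⟩
  unfold answerFn
  rw [dif_pos hex]
  have hc' : hex.choose = c := (query_injOn I r k y hc hex.choose_spec.1 (hx.symm.trans hex.choose_spec.2)).symm
  rw [hc']

/-! ### The ideal answer on a short point -/

variable (I : LatticeInstance) [hZ : IsZLattice ℝ I.lattice]

/-- **The ideal answer on the residues of a grid point with short lattice part is `−m`**: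
`‖⌊x⌋_Λ‖ < λ₁(L*)/2` gives `coords I (point I (sNat x, ℓ_R, b_c)) = −mVec x` (the dual point `−Σⱼ mⱼ b∨ⱼ`
is the close vector). [cite: Regev2009, Lemma 3.14 (proof: "using the CVP oracle, we can recover x"), Lemma 3.4] -/
theorem coords_point_sNat (ℓR bc : ℕ) (x : Fin I.n → ℤ)
    (hd : ‖(ZSpan.floor (eB I (2 ^ ℓR)) (gridPt I (2 ^ ℓR) x) : EuclideanSpace ℝ (Fin I.n))‖ < minNorm (dualLattice I.lattice) / 2) :
    coords I (point I (sNat I (2 ^ ℓR) x, ℓR, bc)) = fun j => -mVec I (2 ^ ℓR) x j := by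
  have hv : -(∑ j, (mVec I (2 ^ ℓR) x j : ℝ) • dualVec I j) ∈ dualLattice I.lattice :=
    Submodule.neg_mem _ (sum_mVec_smul_mem I (2 ^ ℓR) x)
  have hclose : ‖point I (sNat I (2 ^ ℓR) x, ℓR, bc) - ((⟨_, hv⟩ : dualLattice I.lattice) : EuclideanSpace ℝ (Fin I.n))‖ <
      minNorm (dualLattice I.lattice) / 2 := by
    rwa [Submodule.coe_mk, point_sNat_eq_floor_sub, sub_neg_eq_add, sub_add_cancel]
  rw [coords_eq_repr I ⟨_, hv⟩ hclose]
  funext j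
  have hneg : (⟨_, hv⟩ : dualLattice I.lattice) = -⟨_, sum_mVec_smul_mem I (2 ^ ℓR) x⟩ := rfl
  rw [hneg, map_neg, Finsupp.neg_apply, repr_sum_mVec]

/-- **The answer table on such a point** is the offset-binary table of `−m`. [cite: Regev2009, Lemma 3.14 (proof), Lemma 3.4] -/
theorem answerTable_sNat (ℓR bc : ℕ) (x : Fin I.n → ℤ)
    (hd : ‖(ZSpan.floor (eB I (2 ^ ℓR)) (gridPt I (2 ^ ℓR) x) : EuclideanSpace ℝ (Fin I.n))‖ < minNorm (dualLattice I.lattice) / 2) :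
    answerTable I (sNat I (2 ^ ℓR) x, ℓR, bc) = tableZ bc (fun j => -mVec I (2 ^ ℓR) x j) := by
  unfold answerTable
  rw [coords_point_sNat I ℓR bc x hd]

/-- **The erasure of the first register is exact on such a point**: recomposing the branch `ỹ`, the
residues and the ideal answer gives back `x̃`. [cite: Regev2009, Lemma 3.14 (proof: "this allows us to uncompute the first register")] -/
theorem recover_coords_eq (ℓR bc : ℕ) (x : Fin I.n → ℤ)
    (hd : ‖(ZSpan.floor (eB I (2 ^ ℓR)) (gridPt I (2 ^ ℓR) x) : EuclideanSpace ℝ (Fin I.n))‖ < minNorm (dualLattice I.lattice) / 2) :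
    recover I (2 ^ ℓR) (ytil I x) (sNat I (2 ^ ℓR) x) (coords I (point I (sNat I (2 ^ ℓR) x, ℓR, bc))) = x := by
  rw [coords_point_sNat I ℓR bc x hd]
  exact recover_ytil (Nat.two_pow_pos ℓR) x

/-- The same hypotheses phrased with the branch `y(x) = ZSpan.fract_Λ x`: `‖x − y(x)‖ < λ₁(L*)/2`.
[cite: Regev2009, Lemma 3.14 (proof)] -/
theorem recover_coords_eq_of_norm_sub_fract_lt (ℓR bc : ℕ) (x : Fin I.n → ℤ)
    (hd : ‖gridPt I (2 ^ ℓR) x - ZSpan.fract (eB I (2 ^ ℓR)) (gridPt I (2 ^ ℓR) x)‖ < minNorm (dualLattice I.lattice) / 2) :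
    recover I (2 ^ ℓR) (ytil I x) (sNat I (2 ^ ℓR) x) (coords I (point I (sNat I (2 ^ ℓR) x, ℓR, bc))) = x := by
  rw [gridPt_sub_fract] at hd
  exact recover_coords_eq I ℓR bc x hd

end SamplerArith

end Regev2009

end Literature.Computability.Cryptography

end
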